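/-
Copyright: b2b-lace packet (certified numerics seat 3 / enumeration lane, gen 10).  LINK THEOREM for the one
Stage-1 trail read key that `TrailCountTablesD11` left outside the kernel: `bawRows .v2` at `j = 12`.  Nothing of the
record is touched; no fact; no `sorry`.
-/
import Literature.Probability.FitznerVanDerHofstad2017.TrailCountTablesD11
import Literature.Probability.FitznerVanDerHofstad2017.TrailCountTablesN12X11
import Literature.Probability.FitznerVanDerHofstad2017.MeanFieldD11Stage1Eval
import HarnessLib

/-!
# The `d = 11` trail table of the typed Stage 1 equals the kernel-certified counts — the last key `(12, {2})`

`TrailCountTablesD11` proves `bawRows v j = #trailWordsTo 11 j x_v` for every key the Stage-1 cells of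
Fitzner–van der Hofstad's `Percolation.nb` read (cells 11–12: `v ∈ {{0}, {1}, {2} ≙ e₁ + e₂}`, `j ≤ 12`) except
`(j, v) = (12, {2})`, whose trail tree (`7.4·10¹⁰` walks, `2.6·10⁷` nodes of the coded recursion) was beyond that
generation's kernel budget.  `TrailCountTablesN12X11` now certifies `#trailWordsTo 11 12 (e₁ + e₂) = 73897908856`
(`card_trailWordsTo_n12_x11_d11`, from the `d`-uniform polynomial `card_trailWordsTo_n12_x11`); this file records the
link `bawRows .v2 12 = #trailWordsTo 11 12 (e₁ + e₂)` and the now complete row statement `bawRows_v2_eq_card'`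
(`j ≤ 12 = CS`).  With it EVERY trail entry read by the typed Stage 1 (`Stage1Cells`, model `MeanFieldD11Stage1Eval`,
`tab (.baw j v)`) is a kernel-certified count.

References: R. Fitzner, R. van der Hofstad, *Mean-field behavior for nearest-neighbor percolation in `d > 10`*,
Electron. J. Probab. 22 (2017) [FvdH17], notebooks `SRW.nb` §3 (`nrBAW`) and `Percolation.nb` cell 12;
*Generalized approach to the non-backtracking lace expansion*, PTRF 169 (2017) §5.3.1 pp. 1096–1097.
-/

namespace Literature.Probability.FitznerVanDerHofstad2017

open Stage1Cells Stage1Cells.CertD11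

/-- The cell-12 key `nrBAW[12,11,{2}] = bawRows .v2 12 = 73897908856` IS the number of `12`-step trails `0 → e₁ + e₂` on
`ℤ¹¹`. [cite: FitznerVanDerHofstad2017, notebook SRW.nb §3 (nrBAW) and Percolation.nb cell 12] -/
theorem bawRows_v2_eq_card_j12 :
    (bawRows .v2).getD 12 0 = ((trailWordsTo 11 12 (siteOfList [1, 1] 11)).card : ℚ) := by
  rw [card_trailWordsTo_n12_x11_d11]; decide

/-- Cell 12 keys, complete range: `nrBAW[j,11,{2}] = bawRows .v2 j` is the number of `j`-step trails `0 → e₁ + e₂` on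
`ℤ¹¹` for every `j ≤ 12 = CS`. [cite: FitznerVanDerHofstad2017, notebook SRW.nb §3 (nrBAW) and Percolation.nb cell 12] -/
theorem bawRows_v2_eq_card' (j : ℕ) (hj : j ≤ 12) :
    (bawRows .v2).getD j 0 = ((trailWordsTo 11 j (siteOfList [1, 1] 11)).card : ℚ) := by
  rcases Nat.lt_or_ge j 12 with h | h
  · exact bawRows_v2_eq_card j (by omega)
  · obtain rfl : j = 12 := le_antisymm hj h
    exact bawRows_v2_eq_card_j12

end Literature.Probability.FitznerVanDerHofstad2017
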